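import Summits.QuantumFields.YangMills.Theorems.UnitScaleTiltProp7LatticeCubePoincareCov
import Summits.QuantumFields.YangMills.Theorems.UnitScaleTiltProp7LatticeBoxLayerTrace
import HarnessLib

/-!
# LANE II (B9d) — THE BLOCK-TILED CUBE: TILING, BLOCK MEANS, AND THE R-FREE INNER BOUND (flat ∕ small-bond form, ℤᵈ letters)

Item stmt-QuantumFields-19200 (`MinimiserStabilityRegPr`), LANE II «divergence recovery at curved `W`»; ★p1 g19 NAMER WORD №11 (2)(a) («h7 ⊕ h8 of
(B7-BUDGET) in ℤᵈ box letters, block-tiled box»; px9 g7 takes the member reading (a′)).  Pen px4 g7.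

LETTERS (all INLINE, no definition): block side `ℓ ≥ 1`; coarse cube `P := Q(lo, m) = piFinset (Icc (lo i) (lo i + m))` (coarse sites `b`); the block of `b`,
`blk b := Q(ℓ•b, ℓ−1)`; the tiled fine cube `Ωf := Q(ℓ•lo, (m+1)ℓ−1) = ⋃_{b∈P} blk b`; block means `A_b w := |blk b|⁻¹•Σ_{blk b} w` (`|blk b| = ℓ^d`).
* §1 TILING: `mem_blk_iff_ediv` (`x ∈ blk b ↔ ∀ i, x i ∕ ℓ = b i`), `blk_subset_tiled`, `filter_tiled_eq_blk`, ★`sum_tiled_eq_sum_blocks` (`Σ_{Ωf} F = Σ_{b∈P}Σ_{blk b} F`),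
  `card_blk`, `mean_blockMeans_eq_mean` (the mean over `P` of the block means is the fine mean over `Ωf` — EXACT, by tiling).
* §2 ★`norm_sum_sq_le_layer`: `Σ_Ω w = 0`, `Ωf ⊆ Ω` ⇒ `‖Σ_{Ωf} w‖² ≤ |Ω∖Ωf|·Σ_{Ω∖Ωf}‖w‖²` (the constant of a normalised field is a boundary-LAYER quantity).
* §3 ★★`sum_blocks_fluct_le` — SUMMED BLOCK POINCARÉ with small-bond transporters on `Ωf` (✓(B9-gen) `sum_sq_sub_mean_le_cube_cov` block by block):
  `Σ_{b∈P}Σ_{blk b}‖w − A_b w‖² ≤ N(ℓ(ℓ−1)∕2)·(2·COV_T(Ωf) + 8dβ²·Σ_{Ωf}‖w‖²)`.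
* §4 ★★`sum_tiled_sq_le` — THE INNER BOUND: `Σ_{Ωf}‖w‖² ≤ 2·[§3] + 2ℓ^d·(2·N(m(m+1)∕2)·Σ_{b∈P}Σ_μ[b+e_μ∈P]‖A_{b+e_μ}w − A_b w‖² + 2|P|·‖m_f‖²)`,
  `m_f := |Ωf|⁻¹•Σ_{Ωf} w` (flat coarse Poincaré ✓(B9-gen) on the block means + §1's exact mean identity); with §2 the constant `|Ωf|‖m_f‖²` is a LAYER sum
  whenever `w` is normalised on an enclosing set ((B8)(0) on `Ω_i ⊋ Ωf`; the layer mass is ✓(T2)).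
Rung R3 brick; nothing about the YM gap is claimed.
-/

open scoped BigOperators Matrix.Norms.L2Operator
open Finset

namespace Summit.QuantumFields.YangMills.Theorems.Prop7LatticeTiledCube

open Literature.MathematicalPhysics.QuantumFieldTheory.Balaban1983to89
open Literature.MathematicalPhysics.QuantumFieldTheory.Balaban1983to89.B4Eq19LatticeOperators
open B7Prop1Explicit (U1 gaugeAct axialFn gaugeAct_mem)
open B7Eq78Linearization (conjR conjR_apply conjR_sub)
open B8Ineq132 (norm_conjR)
open Summit.QuantumFields.YangMills.Theorems.Prop7LatticeBoxPotentialAlgebra (mem_U1_of_mem_unitaryUnits)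
open Summit.QuantumFields.YangMills.Theorems.Prop7LatticeCubePoincareCov

variable {d N : ℕ}

/-! ## §1 Tiling -/

section Tiling

variable {ℓ : ℕ} (hℓ : 1 ≤ ℓ)
include hℓ

/-- A point lies in the block of `b` iff its coordinatewise integer quotient by `ℓ` is `b`. [folklore] -/
theorem mem_blk_iff_ediv (b x : Zd d) :
    x ∈ Fintype.piFinset (fun i => Finset.Icc ((ℓ : ℤ) * b i) ((ℓ : ℤ) * b i + ((ℓ - 1 : ℕ) : ℤ))) ↔ ∀ i, x i / (ℓ : ℤ) = b i := by
  have hℓ0 : (0 : ℤ) < ℓ := by exact_mod_cast hℓ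
  have hcast : ((ℓ - 1 : ℕ) : ℤ) = (ℓ : ℤ) - 1 := by rw [Nat.cast_sub hℓ]; simp
  rw [mem_cube_iff]
  refine forall_congr' fun i => ?_
  rw [hcast]
  constructor
  · rintro ⟨h1, h2⟩
    apply le_antisymm
    · have : x i / (ℓ : ℤ) < b i + 1 := (Int.ediv_lt_iff_lt_mul hℓ0).2 (by linarith)
      omega
    · exact (Int.le_ediv_iff_mul_le hℓ0).2 (by linarith)
  · intro h
    have h1 : b i ≤ x i / (ℓ : ℤ) := h.symm.le
    have h2 : x i / (ℓ : ℤ) < b i + 1 := by rw [h]; exact lt_add_one _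
    rw [Int.le_ediv_iff_mul_le hℓ0] at h1
    rw [Int.ediv_lt_iff_lt_mul hℓ0] at h2
    constructor <;> linarith

/-- The coordinatewise quotient maps the tiled cube into the coarse cube. [folklore] -/
theorem ediv_mem_coarse (lo : Zd d) (m : ℕ) {x : Zd d}
    (hx : x ∈ Fintype.piFinset (fun i => Finset.Icc ((ℓ : ℤ) * lo i) ((ℓ : ℤ) * lo i + (((m + 1) * ℓ - 1 : ℕ) : ℤ)))) :
    (fun i => x i / (ℓ : ℤ)) ∈ Fintype.piFinset (fun i => Finset.Icc (lo i) (lo i + m)) := by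
  have hℓ0 : (0 : ℤ) < ℓ := by exact_mod_cast hℓ
  have hcast : (((m + 1) * ℓ - 1 : ℕ) : ℤ) = ((m : ℤ) + 1) * ℓ - 1 := by
    have : 1 ≤ (m + 1) * ℓ := le_trans hℓ (Nat.le_mul_of_pos_left ℓ (Nat.succ_pos m))
    rw [Nat.cast_sub this]; push_cast; ring
  rw [mem_cube_iff] at hx ⊢
  intro i
  obtain ⟨h1, h2⟩ := hx i
  rw [hcast] at h2
  constructor
  · exact (Int.le_ediv_iff_mul_le hℓ0).2 (by linarith)
  · have : x i / (ℓ : ℤ) < lo i + m + 1 := (Int.ediv_lt_iff_lt_mul hℓ0).2 (by nlinarith)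
    omega

/-- Blocks of coarse-cube sites lie in the tiled cube. [folklore] -/
theorem blk_subset_tiled (lo : Zd d) (m : ℕ) {b : Zd d} (hb : b ∈ Fintype.piFinset (fun i => Finset.Icc (lo i) (lo i + m))) :
    Fintype.piFinset (fun i => Finset.Icc ((ℓ : ℤ) * b i) ((ℓ : ℤ) * b i + ((ℓ - 1 : ℕ) : ℤ)))
      ⊆ Fintype.piFinset (fun i => Finset.Icc ((ℓ : ℤ) * lo i) ((ℓ : ℤ) * lo i + (((m + 1) * ℓ - 1 : ℕ) : ℤ))) := by
  have hℓ0 : (0 : ℤ) < ℓ := by exact_mod_cast hℓ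
  have hc1 : ((ℓ - 1 : ℕ) : ℤ) = (ℓ : ℤ) - 1 := by rw [Nat.cast_sub hℓ]; simp
  have hc2 : (((m + 1) * ℓ - 1 : ℕ) : ℤ) = ((m : ℤ) + 1) * ℓ - 1 := by
    have : 1 ≤ (m + 1) * ℓ := le_trans hℓ (Nat.le_mul_of_pos_left ℓ (Nat.succ_pos m))
    rw [Nat.cast_sub this]; push_cast; ring
  intro x hx
  rw [mem_cube_iff] at hb hx ⊢
  intro i
  obtain ⟨hb1, hb2⟩ := hb i
  obtain ⟨hx1, hx2⟩ := hx i
  rw [hc1] at hx2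
  rw [hc2]
  constructor <;> nlinarith

/-- The fibre of the quotient map over a coarse-cube site is its block. [folklore] -/
theorem filter_tiled_eq_blk [DecidableEq (Zd d)] (lo : Zd d) (m : ℕ) {b : Zd d} (hb : b ∈ Fintype.piFinset (fun i => Finset.Icc (lo i) (lo i + m))) :
    (Fintype.piFinset (fun i => Finset.Icc ((ℓ : ℤ) * lo i) ((ℓ : ℤ) * lo i + (((m + 1) * ℓ - 1 : ℕ) : ℤ)))).filter
        (fun x => (fun i => x i / (ℓ : ℤ)) = b)
      = Fintype.piFinset (fun i => Finset.Icc ((ℓ : ℤ) * b i) ((ℓ : ℤ) * b i + ((ℓ - 1 : ℕ) : ℤ))) := by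
  ext x
  rw [Finset.mem_filter, mem_blk_iff_ediv hℓ, funext_iff]
  constructor
  · exact fun h => h.2
  · exact fun h => ⟨blk_subset_tiled hℓ lo m hb ((mem_blk_iff_ediv hℓ b x).2 h), h⟩

/-- ★ **TILING**: a sum over the tiled cube is the sum over the coarse cube of the block sums. [folklore] -/
theorem sum_tiled_eq_sum_blocks {M : Type*} [AddCommMonoid M] (lo : Zd d) (m : ℕ) (F : Zd d → M) :
    ∑ x ∈ Fintype.piFinset (fun i => Finset.Icc ((ℓ : ℤ) * lo i) ((ℓ : ℤ) * lo i + (((m + 1) * ℓ - 1 : ℕ) : ℤ))), F x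
      = ∑ b ∈ Fintype.piFinset (fun i => Finset.Icc (lo i) (lo i + m)),
          ∑ x ∈ Fintype.piFinset (fun i => Finset.Icc ((ℓ : ℤ) * b i) ((ℓ : ℤ) * b i + ((ℓ - 1 : ℕ) : ℤ))), F x := by
  classical
  rw [← Finset.sum_fiberwise_of_maps_to (fun x hx => ediv_mem_coarse hℓ lo m hx) F]
  exact Finset.sum_congr rfl fun b hb => by rw [filter_tiled_eq_blk hℓ lo m hb]

/-- The cardinality of a block. [folklore] -/
theorem card_blk (b : Zd d) : (Fintype.piFinset (fun i => Finset.Icc ((ℓ : ℤ) * b i) ((ℓ : ℤ) * b i + ((ℓ - 1 : ℕ) : ℤ)))).card = ℓ ^ d := by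
  rw [card_cube_eq, Nat.sub_add_cancel hℓ]

/-- The cardinality of the tiled cube. [folklore] -/
theorem card_tiled (lo : Zd d) (m : ℕ) :
    (Fintype.piFinset (fun i => Finset.Icc ((ℓ : ℤ) * lo i) ((ℓ : ℤ) * lo i + (((m + 1) * ℓ - 1 : ℕ) : ℤ)))).card
      = (Fintype.piFinset (fun i => Finset.Icc (lo i) (lo i + m))).card * ℓ ^ d := by
  classical
  rw [Finset.card_eq_sum_ones, sum_tiled_eq_sum_blocks hℓ lo m (fun _ => 1)]
  simp only [card_blk hℓ, Finset.sum_const, smul_eq_mul, mul_one]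

/-- ★ **THE MEAN OF THE BLOCK MEANS IS THE FINE MEAN** (exact, by tiling). [folklore] -/
theorem mean_blockMeans_eq_mean (lo : Zd d) (m : ℕ) (w : Zd d → Matrix (Fin N) (Fin N) ℂ) :
    (((Fintype.piFinset (fun i => Finset.Icc (lo i) (lo i + m))).card : ℝ) : ℂ)⁻¹
        • ∑ b ∈ Fintype.piFinset (fun i => Finset.Icc (lo i) (lo i + m)),
            ((((Fintype.piFinset (fun i => Finset.Icc ((ℓ : ℤ) * b i) ((ℓ : ℤ) * b i + ((ℓ - 1 : ℕ) : ℤ)))).card : ℝ) : ℂ)⁻¹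
              • ∑ x ∈ Fintype.piFinset (fun i => Finset.Icc ((ℓ : ℤ) * b i) ((ℓ : ℤ) * b i + ((ℓ - 1 : ℕ) : ℤ))), w x)
      = (((Fintype.piFinset (fun i => Finset.Icc ((ℓ : ℤ) * lo i) ((ℓ : ℤ) * lo i + (((m + 1) * ℓ - 1 : ℕ) : ℤ)))).card : ℝ) : ℂ)⁻¹
        • ∑ x ∈ Fintype.piFinset (fun i => Finset.Icc ((ℓ : ℤ) * lo i) ((ℓ : ℤ) * lo i + (((m + 1) * ℓ - 1 : ℕ) : ℤ))), w x := by
  classical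
  simp only [card_blk hℓ]
  rw [← Finset.smul_sum, smul_smul, ← sum_tiled_eq_sum_blocks hℓ lo m w, card_tiled hℓ lo m]
  congr 1
  have hℓ0 : ((ℓ : ℝ) : ℂ) ≠ 0 := by exact_mod_cast (show (ℓ : ℝ) ≠ 0 by exact_mod_cast (by omega : ℓ ≠ 0))
  push_cast
  rw [mul_inv]

end Tiling

/-! ## §2 Generic rows -/

/-- ★ **THE CONSTANT IS A LAYER QUANTITY**: `Σ_Ω w = 0`, `Ωf ⊆ Ω` ⇒ `‖Σ_{Ωf} w‖² ≤ |Ω∖Ωf|·Σ_{Ω∖Ωf}‖w‖²`. [folklore] -/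
theorem norm_sum_sq_le_layer [DecidableEq (Zd d)] {E : Type*} [SeminormedAddCommGroup E] {Ω Ωf : Finset (Zd d)} (hsub : Ωf ⊆ Ω)
    (w : Zd d → E) (h0 : ∑ x ∈ Ω, w x = 0) : ‖∑ x ∈ Ωf, w x‖ ^ 2 ≤ (Ω \ Ωf).card * ∑ x ∈ Ω \ Ωf, ‖w x‖ ^ 2 := by
  -- the constant of a normalised field is a boundary-layer sum
  rw [← Finset.sum_sdiff hsub] at h0
  have h1 : ∑ x ∈ Ωf, w x = -∑ x ∈ Ω \ Ωf, w x := eq_neg_of_add_eq_zero_right h0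
  rw [h1, norm_neg]
  -- Cauchy–Schwarz
  have h2 : ‖∑ x ∈ Ω \ Ωf, w x‖ ≤ ∑ x ∈ Ω \ Ωf, ‖w x‖ := norm_sum_le _ _
  exact (pow_le_pow_left₀ (norm_nonneg _) h2 2).trans (sq_sum_le_card_mul_sum_sq (s := Ω \ Ωf) (f := fun x => ‖w x‖))

/-! ## §3 Summed block Poincaré (small-bond transporters on the tiled cube) -/

section Blocks

variable [NeZero N] {ℓ : ℕ} (hℓ : 1 ≤ ℓ)
include hℓ

/-- ★★ **SUMMED BLOCK POINCARÉ**: `T` unitary with `‖T y μ − 1‖ ≤ β` on the bonds of the tiled cube `Ωf`; then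
`Σ_{b∈P}Σ_{blk b}‖w − A_b w‖² ≤ N·((ℓ−1)ℓ∕2)·(2·Σ_{Ωf}Σ_μ[x+e_μ∈Ωf]‖R(T x μ)w(x+e_μ) − w x‖² + 8dβ²·Σ_{Ωf}‖w‖²)` (✓(B9-gen) block by block; inside-block bonds are
inside-`Ωf` bonds). [cite: Balaban1983RegularityDecay, (2.27) p.580; Balaban1985Averaging, pp.24-25] -/
theorem sum_blocks_fluct_le (lo : Zd d) (m : ℕ) {β : ℝ}
    (T : Zd d → Fin d → (Matrix (Fin N) (Fin N) ℂ)ˣ) (hT : ∀ y μ, T y μ ∈ U1 (Matrix (Fin N) (Fin N) ℂ))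
    (hTβ : ∀ (y : Zd d) (μ : Fin d), y ∈ Fintype.piFinset (fun i => Finset.Icc ((ℓ : ℤ) * lo i) ((ℓ : ℤ) * lo i + (((m + 1) * ℓ - 1 : ℕ) : ℤ))) →
      y + unitVec μ ∈ Fintype.piFinset (fun i => Finset.Icc ((ℓ : ℤ) * lo i) ((ℓ : ℤ) * lo i + (((m + 1) * ℓ - 1 : ℕ) : ℤ))) →
      ‖(T y μ : Matrix (Fin N) (Fin N) ℂ) - 1‖ ≤ β)
    (w : Zd d → Matrix (Fin N) (Fin N) ℂ) :
    ∑ b ∈ Fintype.piFinset (fun i => Finset.Icc (lo i) (lo i + m)),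
        ∑ x ∈ Fintype.piFinset (fun i => Finset.Icc ((ℓ : ℤ) * b i) ((ℓ : ℤ) * b i + ((ℓ - 1 : ℕ) : ℤ))),
          ‖w x - (((ℓ ^ d : ℕ) : ℝ) : ℂ)⁻¹ • ∑ x' ∈ Fintype.piFinset (fun i => Finset.Icc ((ℓ : ℤ) * b i) ((ℓ : ℤ) * b i + ((ℓ - 1 : ℕ) : ℤ))), w x'‖ ^ 2
      ≤ N * (((ℓ - 1 : ℕ) : ℝ) * ((ℓ - 1 : ℕ) + 1) / 2) *
        (2 * ∑ x ∈ Fintype.piFinset (fun i => Finset.Icc ((ℓ : ℤ) * lo i) ((ℓ : ℤ) * lo i + (((m + 1) * ℓ - 1 : ℕ) : ℤ))), ∑ μ,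
            (if x + unitVec μ ∈ Fintype.piFinset (fun i => Finset.Icc ((ℓ : ℤ) * lo i) ((ℓ : ℤ) * lo i + (((m + 1) * ℓ - 1 : ℕ) : ℤ)))
              then ‖conjR (T x μ) (w (x + unitVec μ)) - w x‖ ^ 2 else 0)
          + 8 * d * β ^ 2 * ∑ x ∈ Fintype.piFinset (fun i => Finset.Icc ((ℓ : ℤ) * lo i) ((ℓ : ℤ) * lo i + (((m + 1) * ℓ - 1 : ℕ) : ℤ))), ‖w x‖ ^ 2) := by
  classical
  set Ωf := Fintype.piFinset (fun i => Finset.Icc ((ℓ : ℤ) * lo i) ((ℓ : ℤ) * lo i + (((m + 1) * ℓ - 1 : ℕ) : ℤ))) with hΩf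
  set P := Fintype.piFinset (fun i => Finset.Icc (lo i) (lo i + (m : ℤ))) with hP
  set c : ℝ := ((ℓ - 1 : ℕ) : ℝ) * ((ℓ - 1 : ℕ) + 1) / 2 with hc
  have hc0 : 0 ≤ c := by rw [hc]; positivity
  -- one block
  have hblk : ∀ b ∈ P,
      ∑ x ∈ Fintype.piFinset (fun i => Finset.Icc ((ℓ : ℤ) * b i) ((ℓ : ℤ) * b i + ((ℓ - 1 : ℕ) : ℤ))),
          ‖w x - (((ℓ ^ d : ℕ) : ℝ) : ℂ)⁻¹ • ∑ x' ∈ Fintype.piFinset (fun i => Finset.Icc ((ℓ : ℤ) * b i) ((ℓ : ℤ) * b i + ((ℓ - 1 : ℕ) : ℤ))), w x'‖ ^ 2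
        ≤ N * c * (2 * ∑ x ∈ Fintype.piFinset (fun i => Finset.Icc ((ℓ : ℤ) * b i) ((ℓ : ℤ) * b i + ((ℓ - 1 : ℕ) : ℤ))), ∑ μ,
              (if x + unitVec μ ∈ Ωf then ‖conjR (T x μ) (w (x + unitVec μ)) - w x‖ ^ 2 else 0)
            + 8 * d * β ^ 2 * ∑ x ∈ Fintype.piFinset (fun i => Finset.Icc ((ℓ : ℤ) * b i) ((ℓ : ℤ) * b i + ((ℓ - 1 : ℕ) : ℤ))), ‖w x‖ ^ 2) := by
    intro b hb
    have hsub := blk_subset_tiled hℓ lo m hb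
    have hTb : ∀ (y : Zd d) (μ : Fin d), y ∈ Fintype.piFinset (fun i => Finset.Icc ((ℓ : ℤ) * b i) ((ℓ : ℤ) * b i + ((ℓ - 1 : ℕ) : ℤ))) →
        y + unitVec μ ∈ Fintype.piFinset (fun i => Finset.Icc ((ℓ : ℤ) * b i) ((ℓ : ℤ) * b i + ((ℓ - 1 : ℕ) : ℤ))) →
        ‖(T y μ : Matrix (Fin N) (Fin N) ℂ) - 1‖ ≤ β := fun y μ hy hyμ => hTβ y μ (hsub hy) (hsub hyμ)
    have h := sum_sq_sub_mean_le_cube_cov (N := N) (fun i => (ℓ : ℤ) * b i) (ℓ - 1) T hT hTb w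
    simp only [card_blk hℓ] at h
    refine h.trans (mul_le_mul_of_nonneg_left (add_le_add (mul_le_mul_of_nonneg_left
      (Finset.sum_le_sum fun x _ => Finset.sum_le_sum fun μ _ => ?_) (by norm_num)) le_rfl) (by positivity))
    by_cases h1 : x + unitVec μ ∈ Fintype.piFinset (fun i => Finset.Icc ((ℓ : ℤ) * b i) ((ℓ : ℤ) * b i + ((ℓ - 1 : ℕ) : ℤ)))
    · rw [if_pos h1, if_pos (hsub h1)]
    · rw [if_neg h1]; split_ifs <;> positivity
  refine (Finset.sum_le_sum hblk).trans (le_of_eq ?_)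
  rw [← Finset.mul_sum, Finset.sum_add_distrib, ← Finset.mul_sum, ← Finset.mul_sum,
    ← sum_tiled_eq_sum_blocks hℓ lo m (fun x => ∑ μ, (if x + unitVec μ ∈ Ωf then ‖conjR (T x μ) (w (x + unitVec μ)) - w x‖ ^ 2 else 0)),
    ← sum_tiled_eq_sum_blocks hℓ lo m (fun x => ‖w x‖ ^ 2)]

end Blocks

/-! ## §4 The R-free inner bound on the tiled cube -/

section Inner

variable [NeZero N] {ℓ : ℕ} (hℓ : 1 ≤ ℓ)
include hℓ

/-- ★★ **(B9d) THE INNER BOUND ON A BLOCK-TILED CUBE** (flat block means; small-bond transporters for the fluctuation): with `A_b w := ℓ^{−d}•Σ_{blk b} w` and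
`m_f := |Ωf|⁻¹•Σ_{Ωf} w`,
`Σ_{Ωf}‖w‖² ≤ 2·N((ℓ−1)ℓ∕2)·(2·COV_T(Ωf) + 8dβ²Σ_{Ωf}‖w‖²) + 2ℓ^d·(2·N(m(m+1)∕2)·Σ_{b∈P}Σ_μ[b+e_μ∈P]‖A_{b+e_μ}w − A_b w‖² + 2|P|·‖m_f‖²)`
(tiling + fluctuation∕mean split + ✓(B9-gen) twice + the exact mean identity).  The constant `|P|ℓ^d‖m_f‖² = |Ωf|‖m_f‖²` is a LAYER sum by
`norm_sum_sq_le_layer` when `w` is normalised on an enclosing set. [cite: Balaban1983RegularityDecay, (2.27) p.580; Balaban1985Averaging, pp.24-25] -/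
theorem sum_tiled_sq_le (lo : Zd d) (m : ℕ) {β : ℝ}
    (T : Zd d → Fin d → (Matrix (Fin N) (Fin N) ℂ)ˣ) (hT : ∀ y μ, T y μ ∈ U1 (Matrix (Fin N) (Fin N) ℂ))
    (hTβ : ∀ (y : Zd d) (μ : Fin d), y ∈ Fintype.piFinset (fun i => Finset.Icc ((ℓ : ℤ) * lo i) ((ℓ : ℤ) * lo i + (((m + 1) * ℓ - 1 : ℕ) : ℤ))) →
      y + unitVec μ ∈ Fintype.piFinset (fun i => Finset.Icc ((ℓ : ℤ) * lo i) ((ℓ : ℤ) * lo i + (((m + 1) * ℓ - 1 : ℕ) : ℤ))) →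
      ‖(T y μ : Matrix (Fin N) (Fin N) ℂ) - 1‖ ≤ β)
    (w : Zd d → Matrix (Fin N) (Fin N) ℂ) :
    ∑ x ∈ Fintype.piFinset (fun i => Finset.Icc ((ℓ : ℤ) * lo i) ((ℓ : ℤ) * lo i + (((m + 1) * ℓ - 1 : ℕ) : ℤ))), ‖w x‖ ^ 2
      ≤ 2 * (N * (((ℓ - 1 : ℕ) : ℝ) * ((ℓ - 1 : ℕ) + 1) / 2) *
          (2 * ∑ x ∈ Fintype.piFinset (fun i => Finset.Icc ((ℓ : ℤ) * lo i) ((ℓ : ℤ) * lo i + (((m + 1) * ℓ - 1 : ℕ) : ℤ))), ∑ μ,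
              (if x + unitVec μ ∈ Fintype.piFinset (fun i => Finset.Icc ((ℓ : ℤ) * lo i) ((ℓ : ℤ) * lo i + (((m + 1) * ℓ - 1 : ℕ) : ℤ)))
                then ‖conjR (T x μ) (w (x + unitVec μ)) - w x‖ ^ 2 else 0)
            + 8 * d * β ^ 2 * ∑ x ∈ Fintype.piFinset (fun i => Finset.Icc ((ℓ : ℤ) * lo i) ((ℓ : ℤ) * lo i + (((m + 1) * ℓ - 1 : ℕ) : ℤ))), ‖w x‖ ^ 2))
        + 2 * (ℓ ^ d : ℕ) *
          (2 * (N * ((m : ℝ) * (m + 1) / 2) *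
              ∑ b ∈ Fintype.piFinset (fun i => Finset.Icc (lo i) (lo i + m)), ∑ μ,
                (if b + unitVec μ ∈ Fintype.piFinset (fun i => Finset.Icc (lo i) (lo i + m)) then
                  ‖(((ℓ ^ d : ℕ) : ℝ) : ℂ)⁻¹ • ∑ x' ∈ Fintype.piFinset (fun i => Finset.Icc ((ℓ : ℤ) * (b + unitVec μ) i) ((ℓ : ℤ) * (b + unitVec μ) i + ((ℓ - 1 : ℕ) : ℤ))), w x'
                    - (((ℓ ^ d : ℕ) : ℝ) : ℂ)⁻¹ • ∑ x' ∈ Fintype.piFinset (fun i => Finset.Icc ((ℓ : ℤ) * b i) ((ℓ : ℤ) * b i + ((ℓ - 1 : ℕ) : ℤ))), w x'‖ ^ 2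
                else 0))
            + 2 * (Fintype.piFinset (fun i => Finset.Icc (lo i) (lo i + m))).card *
              ‖(((Fintype.piFinset (fun i => Finset.Icc ((ℓ : ℤ) * lo i) ((ℓ : ℤ) * lo i + (((m + 1) * ℓ - 1 : ℕ) : ℤ)))).card : ℝ) : ℂ)⁻¹
                • ∑ x ∈ Fintype.piFinset (fun i => Finset.Icc ((ℓ : ℤ) * lo i) ((ℓ : ℤ) * lo i + (((m + 1) * ℓ - 1 : ℕ) : ℤ))), w x‖ ^ 2) := by
  classical
  set Ωf := Fintype.piFinset (fun i => Finset.Icc ((ℓ : ℤ) * lo i) ((ℓ : ℤ) * lo i + (((m + 1) * ℓ - 1 : ℕ) : ℤ))) with hΩf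
  set P := Fintype.piFinset (fun i => Finset.Icc (lo i) (lo i + (m : ℤ))) with hP
  -- the block means as a coarse function
  set W : Zd d → Matrix (Fin N) (Fin N) ℂ := fun b =>
    (((ℓ ^ d : ℕ) : ℝ) : ℂ)⁻¹ • ∑ x' ∈ Fintype.piFinset (fun i => Finset.Icc ((ℓ : ℤ) * b i) ((ℓ : ℤ) * b i + ((ℓ - 1 : ℕ) : ℤ))), w x' with hW
  set M : Matrix (Fin N) (Fin N) ℂ := (((Ωf.card : ℝ)) : ℂ)⁻¹ • ∑ x ∈ Ωf, w x with hM
  -- the fluctuation/mean split `Σ_S‖f‖² ≤ 2Σ_S‖f − A‖² + 2|S|‖A‖²`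
  have hsplit : ∀ (S : Finset (Zd d)) (f : Zd d → Matrix (Fin N) (Fin N) ℂ) (A : Matrix (Fin N) (Fin N) ℂ),
      ∑ x ∈ S, ‖f x‖ ^ 2 ≤ 2 * ∑ x ∈ S, ‖f x - A‖ ^ 2 + 2 * S.card * ‖A‖ ^ 2 := by
    intro S f A
    have h : ∀ x ∈ S, ‖f x‖ ^ 2 ≤ 2 * ‖f x - A‖ ^ 2 + 2 * ‖A‖ ^ 2 := by
      intro x _
      have h1 : ‖f x‖ ≤ ‖f x - A‖ + ‖A‖ := by have := norm_add_le (f x - A) A; rwa [sub_add_cancel] at this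
      have h0 : 0 ≤ ‖f x - A‖ + ‖A‖ := by positivity
      nlinarith [pow_le_pow_left₀ (norm_nonneg _) h1 2, sq_nonneg (‖f x - A‖ - ‖A‖)]
    refine (Finset.sum_le_sum h).trans (le_of_eq ?_)
    rw [Finset.sum_add_distrib, ← Finset.mul_sum, Finset.sum_const, nsmul_eq_mul]; ring
  -- step 1: tiling and the fluctuation/mean split on each block
  have h1 : ∑ x ∈ Ωf, ‖w x‖ ^ 2 ≤ 2 * ∑ b ∈ P, ∑ x ∈ Fintype.piFinset (fun i => Finset.Icc ((ℓ : ℤ) * b i) ((ℓ : ℤ) * b i + ((ℓ - 1 : ℕ) : ℤ))),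
        ‖w x - W b‖ ^ 2 + 2 * (ℓ ^ d : ℕ) * ∑ b ∈ P, ‖W b‖ ^ 2 := by
    rw [hΩf, sum_tiled_eq_sum_blocks hℓ lo m (fun x => ‖w x‖ ^ 2), Finset.mul_sum, Finset.mul_sum, ← Finset.sum_add_distrib]
    refine Finset.sum_le_sum fun b _ => ?_
    have h := hsplit (Fintype.piFinset (fun i => Finset.Icc ((ℓ : ℤ) * b i) ((ℓ : ℤ) * b i + ((ℓ - 1 : ℕ) : ℤ)))) w (W b)
    rw [card_blk hℓ] at h
    linarith
  -- step 2: the means: split around their mean `M` (= the fine mean) and flat coarse Poincaré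
  have hMean : (((P.card : ℝ)) : ℂ)⁻¹ • ∑ b ∈ P, W b = M := by
    have h := mean_blockMeans_eq_mean (N := N) hℓ lo m w
    simp only [card_blk hℓ] at h
    exact h
  have h2 : ∑ b ∈ P, ‖W b‖ ^ 2 ≤ 2 * ∑ b ∈ P, ‖W b - M‖ ^ 2 + 2 * P.card * ‖M‖ ^ 2 := hsplit P W M
  have h3 : ∑ b ∈ P, ‖W b - M‖ ^ 2 ≤ N * ((m : ℝ) * (m + 1) / 2) * ∑ b ∈ P, ∑ μ, (if b + unitVec μ ∈ P then ‖W (b + unitVec μ) - W b‖ ^ 2 else 0) := by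
    have h := sum_sq_sub_mean_le_cube_matrix (N := N) lo m W
    rw [← hP, hMean] at h
    exact h
  -- assemble
  have hℓd : (0 : ℝ) ≤ (ℓ ^ d : ℕ) := Nat.cast_nonneg _
  have hfl := sum_blocks_fluct_le (N := N) hℓ lo m T hT hTβ w
  simp only [hW] at h1 h2 h3 ⊢
  nlinarith [mul_le_mul_of_nonneg_left h2 (by positivity : (0 : ℝ) ≤ 2 * (ℓ ^ d : ℕ)),
    mul_le_mul_of_nonneg_left h3 (by positivity : (0 : ℝ) ≤ 2 * (ℓ ^ d : ℕ) * 2), hfl, h1]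

end Inner

/-! ## §5 Inside a box with the plaquette bound (the box axial gauge) -/

section Plaq

variable [NeZero N] {ℓ : ℕ} (hℓ : 1 ≤ ℓ)
include hℓ

/-- ★★ **(B9d) FROM THE PLAQUETTE BOUND**: `Ωf ⊆ Q_R(z)`, `V` unitary with `PlaqSmall V (z−R) (z+R) α`, `u := axialFn V (z−R)`, `w := R(u ·)φ` (the box axial gauge);
then `sum_tiled_sq_le` holds for `φ` with the covariant differences `R(V x μ)φ(x+e_μ) − φ x` on the right and `β = 2dRα` (✓`norm_axial_sub_one_le_of_plaqSmall`),
the block means and the fine mean being those of `w` (the AXIAL means). [cite: Balaban1983RegularityDecay, (2.27) p.580; Balaban1985Averaging, pp.24-25] -/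
theorem sum_tiled_sq_le_plaq (lo : Zd d) (m : ℕ) {z : Zd d} {R : ℤ} {α : ℝ} (hα : 0 ≤ α)
    (V : Zd d → Fin d → (Matrix (Fin N) (Fin N) ℂ)ˣ) (hV : ∀ y μ, V y μ ∈ B7Prop2Explicit.unitaryUnits (Matrix (Fin N) (Fin N) ℂ))
    (hP : B8Lemma1NonAbelian.PlaqSmall V (fun i => z i - R) (fun i => z i + R) α)
    (hsub : Fintype.piFinset (fun i => Finset.Icc ((ℓ : ℤ) * lo i) ((ℓ : ℤ) * lo i + (((m + 1) * ℓ - 1 : ℕ) : ℤ))) ⊆ box z R)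
    (φ : Zd d → Matrix (Fin N) (Fin N) ℂ) :
    ∑ x ∈ Fintype.piFinset (fun i => Finset.Icc ((ℓ : ℤ) * lo i) ((ℓ : ℤ) * lo i + (((m + 1) * ℓ - 1 : ℕ) : ℤ))), ‖φ x‖ ^ 2
      ≤ 2 * (N * (((ℓ - 1 : ℕ) : ℝ) * ((ℓ - 1 : ℕ) + 1) / 2) *
          (2 * ∑ x ∈ Fintype.piFinset (fun i => Finset.Icc ((ℓ : ℤ) * lo i) ((ℓ : ℤ) * lo i + (((m + 1) * ℓ - 1 : ℕ) : ℤ))), ∑ μ,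
              (if x + unitVec μ ∈ Fintype.piFinset (fun i => Finset.Icc ((ℓ : ℤ) * lo i) ((ℓ : ℤ) * lo i + (((m + 1) * ℓ - 1 : ℕ) : ℤ)))
                then ‖conjR (V x μ) (φ (x + unitVec μ)) - φ x‖ ^ 2 else 0)
            + 8 * d * (2 * d * R * α) ^ 2 *
              ∑ x ∈ Fintype.piFinset (fun i => Finset.Icc ((ℓ : ℤ) * lo i) ((ℓ : ℤ) * lo i + (((m + 1) * ℓ - 1 : ℕ) : ℤ))), ‖φ x‖ ^ 2))
        + 2 * (ℓ ^ d : ℕ) *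
          (2 * (N * ((m : ℝ) * (m + 1) / 2) *
              ∑ b ∈ Fintype.piFinset (fun i => Finset.Icc (lo i) (lo i + m)), ∑ μ,
                (if b + unitVec μ ∈ Fintype.piFinset (fun i => Finset.Icc (lo i) (lo i + m)) then
                  ‖(((ℓ ^ d : ℕ) : ℝ) : ℂ)⁻¹ • ∑ x' ∈ Fintype.piFinset (fun i => Finset.Icc ((ℓ : ℤ) * (b + unitVec μ) i) ((ℓ : ℤ) * (b + unitVec μ) i + ((ℓ - 1 : ℕ) : ℤ))),
                      conjR (axialFn V (fun i => z i - R) x') (φ x')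
                    - (((ℓ ^ d : ℕ) : ℝ) : ℂ)⁻¹ • ∑ x' ∈ Fintype.piFinset (fun i => Finset.Icc ((ℓ : ℤ) * b i) ((ℓ : ℤ) * b i + ((ℓ - 1 : ℕ) : ℤ))),
                      conjR (axialFn V (fun i => z i - R) x') (φ x')‖ ^ 2
                else 0))
            + 2 * (Fintype.piFinset (fun i => Finset.Icc (lo i) (lo i + m))).card *
              ‖(((Fintype.piFinset (fun i => Finset.Icc ((ℓ : ℤ) * lo i) ((ℓ : ℤ) * lo i + (((m + 1) * ℓ - 1 : ℕ) : ℤ)))).card : ℝ) : ℂ)⁻¹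
                • ∑ x ∈ Fintype.piFinset (fun i => Finset.Icc ((ℓ : ℤ) * lo i) ((ℓ : ℤ) * lo i + (((m + 1) * ℓ - 1 : ℕ) : ℤ))),
                    conjR (axialFn V (fun i => z i - R) x) (φ x)‖ ^ 2) := by
  classical
  set u : Zd d → (Matrix (Fin N) (Fin N) ℂ)ˣ := axialFn V (fun i => z i - R) with hu_def
  have hV1 : ∀ x μ, V x μ ∈ U1 (Matrix (Fin N) (Fin N) ℂ) := fun x μ => mem_U1_of_mem_unitaryUnits (hV x μ)
  have hu1 : ∀ x, u x ∈ U1 (Matrix (Fin N) (Fin N) ℂ) := fun x => mem_U1_of_mem_unitaryUnits (B7Prop2Explicit.hol_mem_of hV _ _)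
  have h := sum_tiled_sq_le (N := N) hℓ lo m (β := 2 * d * R * α) (gaugeAct u V) (fun x μ => gaugeAct_mem hV1 hu1 x μ)
    (fun x μ hx hxμ => Prop7LatticeBoxFriedrichsCurved.norm_axial_sub_one_le_of_plaqSmall hα V hV1 hP x μ (hsub hx) (hsub hxμ))
    (fun x => conjR (u x) (φ x))
  have e1 : ∀ x, ‖conjR (u x) (φ x)‖ = ‖φ x‖ := fun x => norm_conjR (hu1 x) (φ x)
  have e2 : ∀ (x : Zd d) (μ : Fin d),
      ‖conjR (gaugeAct u V x μ) (conjR (u (x + unitVec μ)) (φ (x + unitVec μ))) - conjR (u x) (φ x)‖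
        = ‖conjR (V x μ) (φ (x + unitVec μ)) - φ x‖ := by
    intro x μ
    rw [Prop7LatticeBoxFriedrichsCurved.conjR_gaugeAct_conjR, ← conjR_sub, norm_conjR (hu1 x)]
  simp only [e1, e2] at h
  exact h

end Plaq

/-! ## §6 The constant under the axial normalisation ((B8)(0) ⊕ (T2)) -/

section Constant

variable [NeZero N]

/-- ★★ **THE CONSTANT IS SMALL UNDER (B8)(0)**: if `Σ_{Q_R(z)} R(u x)φ x = 0` (`u := axialFn V (z−R)`, the normalisation of ✓`boxLocalPotential`) and
`Q_{R−t}(z) ⊆ Ωf ⊆ Q_R(z)` for some finite `Ωf`, then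
`‖Σ_{Ωf} R(u x)φ x‖² ≤ #(Q_R∖Ωf)·[(4dt∕(2R+1) + 32dt(2R+1)(2dRα)²)·Σ_{Q_R}‖φ‖² + 8t(2R+1)·Σ_{Q_R}Σ_μ[x+e_μ∈Q_R]‖R(V x μ)φ(x+e_μ) − φ x‖²]`
(`norm_sum_sq_le_layer` ⊕ ✓(T2) `sum_layer_sq_le_plaq`). [cite: Balaban1985Averaging, pp.24-25; folklore] -/
theorem norm_sum_axial_sq_le_of_normalised {z : Zd d} {R : ℤ} (hR : 0 ≤ R) (t : ℕ) {α : ℝ} (hα : 0 ≤ α)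
    (V : Zd d → Fin d → (Matrix (Fin N) (Fin N) ℂ)ˣ) (hV : ∀ y μ, V y μ ∈ B7Prop2Explicit.unitaryUnits (Matrix (Fin N) (Fin N) ℂ))
    (hP : B8Lemma1NonAbelian.PlaqSmall V (fun i => z i - R) (fun i => z i + R) α)
    (φ : Zd d → Matrix (Fin N) (Fin N) ℂ) (h0 : ∑ x ∈ box z R, conjR (axialFn V (fun i => z i - R) x) (φ x) = 0)
    {Ωf : Finset (Zd d)} (hsub : Ωf ⊆ box z R) (hinner : box z (R - t) ⊆ Ωf) :
    ‖∑ x ∈ Ωf, conjR (axialFn V (fun i => z i - R) x) (φ x)‖ ^ 2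
      ≤ (box z R \ Ωf).card *
        ((4 * d * t / (2 * (R : ℝ) + 1) + 32 * d * t * (2 * (R : ℝ) + 1) * (2 * d * R * α) ^ 2) * ∑ x ∈ box z R, ‖φ x‖ ^ 2
          + 8 * t * (2 * (R : ℝ) + 1) *
            ∑ x ∈ box z R, ∑ μ, (if x + unitVec μ ∈ box z R then ‖conjR (V x μ) (φ (x + unitVec μ)) - φ x‖ ^ 2 else 0)) := by
  set u : Zd d → (Matrix (Fin N) (Fin N) ℂ)ˣ := axialFn V (fun i => z i - R) with hu_def
  have hu1 : ∀ x, u x ∈ U1 (Matrix (Fin N) (Fin N) ℂ) := fun x => mem_U1_of_mem_unitaryUnits (B7Prop2Explicit.hol_mem_of hV _ _)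
  have h1 := norm_sum_sq_le_layer hsub (fun x => conjR (u x) (φ x)) h0
  have e1 : ∀ x, ‖conjR (u x) (φ x)‖ = ‖φ x‖ := fun x => norm_conjR (hu1 x) (φ x)
  simp only [e1] at h1
  -- the layer `Q_R ∖ Ωf` sits inside `Q_R ∖ Q_{R−t}`
  have hlay : ∑ x ∈ box z R \ Ωf, ‖φ x‖ ^ 2 ≤ ∑ x ∈ box z R \ box z (R - t), ‖φ x‖ ^ 2 :=
    Finset.sum_le_sum_of_subset_of_nonneg (Finset.sdiff_subset_sdiff (Finset.Subset.refl _) hinner) fun x _ _ => by positivity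
  have h2 := Prop7LatticeBoxLayerTrace.sum_layer_sq_le_plaq (N := N) hR t hα V hV hP φ
  exact h1.trans (mul_le_mul_of_nonneg_left (hlay.trans h2) (Nat.cast_nonneg _))

end Constant

end Summit.QuantumFields.YangMills.Theorems.Prop7LatticeTiledCube
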